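import Summits.QuantumFields.QCD.Theses.AnomalyRigidity
import Summits.QuantumFields.QCD.Theorems.HeatSlicedQuarksRobustYangMillsHandoverStubTreeDecayBoundsGerm
import HarnessLib.Audit

/-!
# Birth skeleton (BC3) for the crux `UniformGapFarMoments` (item stmt-QuantumFields-17718)

Route `AnomalyRigidity` (sub-problem QCD), crux decl
`Summit.QuantumFields.QCD.Theses.AnomalyRigidity.UniformGapFarMoments` (rev 6; rank 3; difficulty L;
replaces the misstated `UniformGapTreeDecay`, stmt-16260):

  for `N_f ∈ {2,3}`, ANY regularisation `reg` whose bare coupling scales asymptotically, ANY local observables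
  `V_μ, P` (quark box 1) with weights `u_V, u_P` obeying the m-uniform truncated reflected pair bounds of crux 2
  and CENTRED on the ray, IF the uniform lattice gap `ε` holds along `reg.scheme (m·1) 0 0` for every
  `m ∈ (0, m₁] ⊆ (0, 1]` and the bare masses are eventually on the physical branch, THEN the FAR-REGION weighted
  moments `a_k⁸ ΣΣ_{max(|ξ|,|η|) ≥ R₀} |ξ|^i |η|^j |u_V² u_P ⟨V_μ(x) V_ν(y) P(0)⟩_{k,S,m}|` (`i, j ∈ {1,2}`) are
  bounded by ONE constant for all `m ∈ (0, m₁]`, eventually in `k`, on EVERY torus `S ≥ L_k`.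

Registered by the skeleton-registrar seat `planner-skel-stmt-QuantumFields-17718-0` (route re-audit bin
REPAIRABLE, 2026-08-17) as `Cruxes/UniformGapFarMoments/Lines/birth.lean`.  It is the route-level BIRTH
CERTIFICATE of the crux (≥ 2 named stubs, a kernel-checked composition concluding the crux BY NAME, `sorry`
only inside `stub_*`), deliberately LINE-NEUTRAL, and cut ALONG THE NEGATIVE KNOWLEDGE already attached to the
item (lead c8's finite-torus audit and lead c10's `FINDING-c10-17718-volume.md` of crux 8892: as interfaced,
17718 relates the weights `u` to the physical volume `a_k L_k` nowhere, and the SHAPE of its hypotheses admits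
an abstract slow-mode scenario defeating the conclusion at `S = L_k` whenever `log |u(k)| ≳ ε a_k L_k`; the
free repair is the extra hypothesis (H-vol) `a_k L_k / log (2 + a_k⁻¹ + |u_V(k)| + |u_P(k)|) → ∞`):

* `stub_treeDecayLV : TreeDecayLVStmt` — **the physics, at super-logarithmic volumes** (size L; the
  unobstructed content): the crux's hypotheses PLUS (H-vol) give the m-uniform POINTWISE tree-decay bound of
  the weighted centred three-point function `u_V²u_P⟨V_μ(x)V_ν(y)P(0)⟩` beyond some radius `R₀`:
  `≤ C e^{−ε' max(|ξ|,|η|)} (1 + (a_k + min(|ξ|,|η|,|ξ−η|))^{−σ})`, `ε' > 0`, `σ < 4`, for all `m ∈ (0, m₁]`,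
  eventually in `k`, on every torus `S ≥ L_k` — the conclusion of the superseded item 16260 VERBATIM, now
  behind the three repairs the audits asked for (centring: route review 18:44Z; `β_k → +∞` via asymptotic
  scaling: lead c6; (H-vol): leads c8/c10).  Mechanism foreseen (not imposed): RP transfer / OS realisation of
  the torus functional or of its thermodynamic limit, the landed truncated-Schwarz cut
  (`TransferTruncatedSchwarzBound`, p129979) for a CENTRED isolated observable, the landed decay upgrade
  (`TransferDecayUpgrade`, p131005), axis covariance, and exponential finite-size control on `S ≥ L_k` — the
  one place where (H-vol) is spent (flat-distance contact allowance at the periodic seam included: the seam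
  pairs carry `a_k⁻⁶ e^{−ε a_k S}`, harmless once `a_k L_k ≫ log a_k⁻¹`, which (H-vol) gives).
* `stub_volumeDescent : VolumeDescentStmt` — **the finite-size DESCENT** (size M–L as physics, and the
  isolated INTERFACE DEBT as typed): if the crux's hypotheses hold for `reg` (thresholds `L_k`) and the
  far-region moment bound holds for the volume-ENLARGED regularisation `enlargeL reg L'` (same `a, β, m_crit,
  Z_m`; thresholds `L'_k ≥ L_k`), then it holds for `reg` itself (thresholds `L_k`).  Physically a Lüscher-type
  finite-size statement (corrections between the tori `L_k ≤ S < L'_k` and the large tori are exponentially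
  small in the gap, in physical units).  AS INTERFACED it is exactly where the c8 (b2) / c10 obstruction lives
  (per-pair gap constants of `HasLatticeMassGap` are for UNWEIGHTED observables; nothing ties them to the
  weights at `S = L_k`), so no RP / spectral architecture is known to prove it and no constructible witness is
  known to refute it (c10: "unprovable as interfaced, not false").  Under the route's REPAIRABLE restatement
  (17718 ↦ `UniformGapFarMomentsLV`, i.e. (H-vol) added to the crux) this stub leaves the deciding path
  (`L' = L`), and `stub_treeDecayLV` + the landed summation give the restated crux directly.

`UniformGapFarMoments_of : TreeDecayLVStmt → VolumeDescentStmt → UniformGapFarMoments` is kernel-checked and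
is a genuine argument, not a conjunction seam: super-logarithmic thresholds `L'_k ≥ L_k` always exist
(`exists_superlogVolume`); every hypothesis of the crux is an eventual statement over all tori `S ≥ L_k`, hence
survives the enlargement (`cruxHyps_enlargeL`); `stub_treeDecayLV` on `enlargeL reg L'` gives pointwise tree
decay on `S ≥ L'_k`; the LANDED far-region summation `treeGerm_far_weight_sum`
(Theorems/HeatSlicedQuarksRobustYangMillsHandoverStubTreeDecayBoundsGerm.lean, lead c6 of crux 8892) turns it
into the far-moment bound on `S ≥ L'_k` (`farMoments_of_treeDecay`, using `a_k ≤ 1` eventually); and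
`stub_volumeDescent` brings it down to `S ≥ L_k`.  `uniformGapFarMoments_of_stubs : UniformGapFarMoments`
instantiates it.

## Negative knowledge honoured (read 2026-08-17)
* `Cruxes/UniformGapFarMoments/` had NO workfiles before this one (no `Disproof.lean`, no dead lines, no crux
  ideas); the item's evidence is the planner's repair note and lead c10's FINDING (above), both answered by the
  cut: the debt is ONE named stub, the physics stub carries (H-vol).
* `Theorems/UniformGapTreeDecay/Negative/UniformGapTreeDecayFalseOfGapped.lean`
  (`uniformGapTreeDecay_false_of_gapped`, unit observables `V = P = 1`): `stub_treeDecayLV` carries the two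
  CENTRING clauses `⟨V_μ(x)⟩ = ⟨P(x)⟩ = 0` (with `⟨1⟩ = 1` the unit observable is not centred; with `⟨1⟩ = 0`
  — junk partition function — every expectation vanishes and the bound is trivial), and `N_f ∈ {2,3}`.
* `ledger negatives --problem QuantumFields` (5 entries: RobustYangMillsRG 14958, MirrorModularBoosts 9665,
  AdaptiveCoarseSystem 9494, MultibosonLatticeGap 9599, AdmissibleRootsExist 9603): none concerns tree decay /
  far moments / finite-size descent; no stub is an existence claim over regularisations (9599's shape).
* Junk values: `qcdTorusExpect` is junk `0` when the signed partition function vanishes — then every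
  hypothesis and conclusion here is the trivial `0 ≤ C`; `(a_k + d)^(−σ)` is a real `rpow` of a positive base.
* Typing checklist 4c: no hand-picked constants (`C, ε', σ, R₀` existential; `σ < 4` is the crux's own
  integrability exponent); no Bochner integrals; thresholds only through `reg.L` / `enlargeL`.

## BC3 probes (planner folder `bc/`): for each stub statement `S`, `S → UniformGapFarMoments` and `S → QCD` by
`first | exact? | simpa | aesop` FAIL (files `bc/probe_<stub>_{crux,summit}.lean`; rc and messages in NOTES.md).
-/

noncomputable section

namespace Summit.QuantumFields.QCD.Cruxes.UniformGapFarMoments.Birth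

open scoped BigOperators Topology Classical
open Filter Finset
open Literature.MathematicalPhysics.QuantumFieldTheory
open Literature.Probability.LatticeModels
open Summit.QuantumFields.QCD.Theses.AnomalyRigidity
open Summit.QuantumFields.QCD.Cruxes.RobustYangMillsHandover.LeeYangMassHandover (treeGerm_far_weight_sum)

variable {Nf : ℕ}

/-! ## §0 Currency — verbatim sub-formulas of the crux (thresholds read off `reg.L`) -/

/-- **The m-uniform truncated reflected pair bounds** (verbatim the first hypothesis of the crux = the pair
clause of `AnomalousWardTriple` (b)): for the family `{1, V_μ, P}` with weights `{1, u_V, u_P}`, at positive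
physical times `≥ τ` inside the ball of radius `τ⁻¹`, `‖w²(⟨ΘY ΘX · X Y⟩ − ⟨ΘY ΘX⟩⟨X Y⟩)‖ ≤ C (a_k + |ξ−η|)^{−2σ}`,
`σ < 4`, for all `m ∈ (0, 1]`, eventually in `k`, on every torus `S ≥ L_k`. -/
def PairBounds (reg : QCDRegularisation Nf) (V : Fin 4 → QCDLatticeObservable Nf 1)
    (P : QCDLatticeObservable Nf 1) (uV uP : ℕ → ℝ) : Prop :=
  let ph := fun (k : ℕ) (x : Fin 4 → ℤ) (i : Fin 4) => reg.a k * (x i : ℝ)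
  let E := fun (k S : ℕ) (m : ℝ) X => qcdTorusExpect (reg.β k) (2 * S + 1)
    (fun fl => (reg.scheme (fun _ : Fin Nf => m) 0 0).mq fl k) X
  let O := fun o : Option (Fin 4 ⊕ Unit) =>
    Option.elim o (QCDLatticeObservable.one Nf 1) (Sum.elim V (fun _ : Unit => P))
  let w := fun o : Option (Fin 4 ⊕ Unit) =>
    Option.elim o (fun _ : ℕ => (1 : ℝ)) (Sum.elim (fun _ : Fin 4 => uV) (fun _ : Unit => uP))
  let R2 := fun (S : ℕ) (X Y : QCDLatticeObservable Nf 1) x y U =>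
    Y.osAdjoint.onTorus (2 * S + 1) (siteReflect y) U * X.osAdjoint.onTorus (2 * S + 1) (siteReflect x) U
  let P2 := fun (S : ℕ) (X Y : QCDLatticeObservable Nf 1) x y U =>
    X.onTorus (2 * S + 1) x U * Y.onTorus (2 * S + 1) y U
  ∃ σ : ℝ, σ < 4 ∧ ∀ τ : ℝ, 0 < τ → ∃ C : ℝ, ∀ m : ℝ, 0 < m → m ≤ 1 → ∀ ι₁ ι₂ : Option (Fin 4 ⊕ Unit),
    ∀ᶠ k in Filter.atTop, ∀ S : ℕ, reg.L k ≤ S → ∀ x ∈ box 4 S, ∀ y ∈ box 4 S,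
      τ ≤ ph k x 0 → τ ≤ ph k y 0 → ‖ph k x‖ ≤ τ⁻¹ → ‖ph k y‖ ≤ τ⁻¹ →
        ‖(((w ι₁ k * w ι₂ k) ^ 2 : ℝ) : ℂ) *
            (E k S m (fun U => R2 S (O ι₁) (O ι₂) x y U * P2 S (O ι₁) (O ι₂) x y U) -
              E k S m (R2 S (O ι₁) (O ι₂) x y) * E k S m (P2 S (O ι₁) (O ι₂) x y))‖ ≤
          C * (reg.a k + ‖ph k x - ph k y‖) ^ (-(2 * σ))

/-- **Centring** (verbatim the two centring hypotheses of the crux): the one-point functions of `V_μ` and of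
`P` vanish for `m ∈ (0, m₁]`, eventually in `k`, on every torus `S ≥ L_k`, at every site of the box. -/
def Centred (reg : QCDRegularisation Nf) (V : Fin 4 → QCDLatticeObservable Nf 1)
    (P : QCDLatticeObservable Nf 1) (m₁ : ℝ) : Prop :=
  let E := fun (k S : ℕ) (m : ℝ) X => qcdTorusExpect (reg.β k) (2 * S + 1)
    (fun fl => (reg.scheme (fun _ : Fin Nf => m) 0 0).mq fl k) X
  (∀ m : ℝ, 0 < m → m ≤ m₁ → ∀ μ : Fin 4, ∀ᶠ k in Filter.atTop, ∀ S : ℕ, reg.L k ≤ S →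
      ∀ x ∈ box 4 S, E k S m ((V μ).onTorus (2 * S + 1) x) = 0) ∧
    (∀ m : ℝ, 0 < m → m ≤ m₁ → ∀ᶠ k in Filter.atTop, ∀ S : ℕ, reg.L k ≤ S →
      ∀ x ∈ box 4 S, E k S m (P.onTorus (2 * S + 1) x) = 0)

/-- **The hypothesis kit of the crux** for given data `(reg, V, P, u_V, u_P, ε, m₁)` — verbatim, in the
crux's order: pair bounds; `0 < ε`; `0 < m₁ ≤ 1`; the uniform lattice gap `ε` on the ray `(0, m₁]`; the
physical branch; `N_f ∈ {2,3}`; two-loop asymptotic scaling of the bare coupling; centring. -/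
def CruxHyps (reg : QCDRegularisation Nf) (V : Fin 4 → QCDLatticeObservable Nf 1)
    (P : QCDLatticeObservable Nf 1) (uV uP : ℕ → ℝ) (ε m₁ : ℝ) : Prop :=
  PairBounds reg V P uV uP ∧ 0 < ε ∧ 0 < m₁ ∧ m₁ ≤ 1 ∧
    (∀ m : ℝ, 0 < m → m ≤ m₁ → (reg.scheme (fun _ : Fin Nf => m) 0 0).HasLatticeMassGap ε) ∧
    (∀ m : ℝ, 0 < m → m ≤ m₁ → ∀ fl : Fin Nf, ∀ᶠ k in Filter.atTop,
      (-1 : ℝ) < (reg.scheme (fun _ : Fin Nf => m) 0 0).mq fl k) ∧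
    (Nf = 2 ∨ Nf = 3) ∧ (reg.scheme 0 0 0).HasAsymptoticScaling ∧ Centred reg V P m₁

/-- **(H-vol) — super-logarithmic physical volumes relative to the inverse spacing and the weights** (lead
c10's repair hypothesis, verbatim): `a_k L_k / log (2 + a_k⁻¹ + |u_V(k)| + |u_P(k)|) → ∞`. -/
def HVol (reg : QCDRegularisation Nf) (uV uP : ℕ → ℝ) : Prop :=
  Tendsto (fun k : ℕ => reg.a k * (reg.L k : ℝ) / Real.log (2 + (reg.a k)⁻¹ + |uV k| + |uP k|))
    atTop atTop

/-- **m-uniform pointwise TREE DECAY of the weighted three-point function** (verbatim the conclusion of the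
superseded item 16260 `UniformGapTreeDecay`): beyond some radius `R₀`,
`‖u_V² u_P ⟨V_μ(x)V_ν(y)P(0)⟩‖ ≤ C e^{−ε' max(|ξ|,|η|)} (1 + (a_k + min(|ξ|,|η|,|ξ−η|))^{−σ})`, `ε' > 0`, `σ < 4`,
for all `m ∈ (0, m₁]`, eventually in `k`, on every torus `S ≥ L_k` (`ξ = a_k x`, `η = a_k y`, sup norms). -/
def TreeDecay (reg : QCDRegularisation Nf) (V : Fin 4 → QCDLatticeObservable Nf 1)
    (P : QCDLatticeObservable Nf 1) (uV uP : ℕ → ℝ) (m₁ : ℝ) : Prop :=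
  let ph := fun (k : ℕ) (x : Fin 4 → ℤ) (i : Fin 4) => reg.a k * (x i : ℝ)
  let E := fun (k S : ℕ) (m : ℝ) X => qcdTorusExpect (reg.β k) (2 * S + 1)
    (fun fl => (reg.scheme (fun _ : Fin Nf => m) 0 0).mq fl k) X
  let C3 := fun (k S : ℕ) (m : ℝ) (X Y Z : QCDLatticeObservable Nf 1) x y =>
    E k S m (fun U => X.onTorus (2 * S + 1) x U * Y.onTorus (2 * S + 1) y U * Z.onTorus (2 * S + 1) 0 U)
  ∃ C ε' σ R₀ : ℝ, 0 < ε' ∧ σ < 4 ∧ ∀ m : ℝ, 0 < m → m ≤ m₁ → ∀ μ ν : Fin 4, ∀ᶠ k in Filter.atTop,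
    ∀ S : ℕ, reg.L k ≤ S → ∀ x ∈ box 4 S, ∀ y ∈ box 4 S, R₀ ≤ max ‖ph k x‖ ‖ph k y‖ →
      ‖((uV k * uV k * uP k : ℝ) : ℂ) * C3 k S m (V μ) (V ν) P x y‖ ≤
        C * Real.exp (-(ε' * max ‖ph k x‖ ‖ph k y‖)) *
          (1 + (reg.a k + min ‖ph k x‖ (min ‖ph k y‖ ‖ph k x - ph k y‖)) ^ (-σ))

/-- **m-uniform FAR-REGION weighted moments** (verbatim the conclusion of the crux): there are `R₀` and ONE
constant `C` with `a_k⁸ ΣΣ_{x,y ∈ box S, max(|ξ|,|η|) ≥ R₀} |ξ|^i |η|^j ‖u_V² u_P ⟨V_μ(x)V_ν(y)P(0)⟩‖ ≤ C` for all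
`m ∈ (0, m₁]`, `i, j ∈ {1,2}`, `μ, ν`, eventually in `k`, on every torus `S ≥ L_k`. -/
def FarMoments (reg : QCDRegularisation Nf) (V : Fin 4 → QCDLatticeObservable Nf 1)
    (P : QCDLatticeObservable Nf 1) (uV uP : ℕ → ℝ) (m₁ : ℝ) : Prop :=
  let ph := fun (k : ℕ) (x : Fin 4 → ℤ) (i : Fin 4) => reg.a k * (x i : ℝ)
  let E := fun (k S : ℕ) (m : ℝ) X => qcdTorusExpect (reg.β k) (2 * S + 1)
    (fun fl => (reg.scheme (fun _ : Fin Nf => m) 0 0).mq fl k) X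
  let C3 := fun (k S : ℕ) (m : ℝ) (X Y Z : QCDLatticeObservable Nf 1) x y =>
    E k S m (fun U => X.onTorus (2 * S + 1) x U * Y.onTorus (2 * S + 1) y U * Z.onTorus (2 * S + 1) 0 U)
  ∃ R₀ C : ℝ, ∀ m : ℝ, 0 < m → m ≤ m₁ → ∀ (i j : ℕ), 1 ≤ i → i ≤ 2 → 1 ≤ j → j ≤ 2 → ∀ μ ν : Fin 4,
    ∀ᶠ k in Filter.atTop, ∀ S : ℕ, reg.L k ≤ S →
      (∑ x ∈ box 4 S, ∑ y ∈ box 4 S,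
        if R₀ ≤ max ‖ph k x‖ ‖ph k y‖ then
          reg.a k ^ 8 * ‖ph k x‖ ^ i * ‖ph k y‖ ^ j * ‖((uV k * uV k * uP k : ℝ) : ℂ) * C3 k S m (V μ) (V ν) P x y‖
        else 0) ≤ C

/-- **Volume enlargement** (after lead c10 of crux 8892, `lee_yang_mass_handover.lean` §3): the same
regularisation with larger volume thresholds `L'_k ≥ L_k` — spacings, couplings, critical mass and `Z_m`
unchanged, `a_k L'_k → ∞` a fortiori. [folklore] -/
abbrev enlargeL (reg : QCDRegularisation Nf) (L' : ℕ → ℕ) (hL : ∀ k, reg.L k ≤ L' k) :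
    QCDRegularisation Nf :=
  { reg with
    L := L'
    tendsto_L := tendsto_atTop_mono
      (fun k => mul_le_mul_of_nonneg_left (Nat.cast_le.mpr (hL k)) (reg.a_pos k).le) reg.tendsto_L }

/-! ## §1 The two stub statements -/

/-- **(A) Uniform gap ⇒ m-uniform tree decay of the centred weighted three-point function, AT
SUPER-LOGARITHMIC VOLUMES** (size L).  For every `N_f`, regularisation, observables, weights, `ε`, `m₁`:
the crux's hypotheses (`CruxHyps`: pair bounds, uniform lattice gap `ε` on `(0, m₁]`, physical branch,
`N_f ∈ {2,3}`, asymptotic scaling, centring) together with (H-vol) imply the pointwise tree-decay bound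
(`TreeDecay`) on every torus `S ≥ L_k`, eventually in `k`, uniformly in `m ∈ (0, m₁]`.  Why plausibly true: an
RP transfer / OS realisation of the torus functional along the axis of the largest coordinate (or of its
thermodynamic limit at fixed `k`), the truncated-Schwarz cut for a CENTRED isolated observable
(`TransferData.norm_inner_pow_sub_sq_le`, landed) and the per-vector decay upgrade (landed) give the decay
with the honest constant (the pair-bound quantity at a fixed physical time), and the exponential finite-size /
wrap-around corrections `u³ a⁻ᵖ (a_k S)^{12} e^{−ε' a_k S}` on `S ≥ L_k` vanish exactly under (H-vol).  Why it
might fail: `qcdTorusExpect` is the finite PERIODIC torus functional — a `(−1)^F`-twisted trace, not a state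
and not reflection positive at finite `S` (site-RP is proved only for the antiperiodic functional); the
thermodynamic limit of lattice QCD at the relevant `β_k` is not in the tree; hypercubic cuts need all-axis
control (lead c8 (b1)/(b3)). [cite: Luscher1977] [cite: OsterwalderSeiler1978, §§2–4]
[cite: GlimmJaffe1987, §6.1 and Ch. 19] -/
def TreeDecayLVStmt : Prop :=
  ∀ (Nf : ℕ) (reg : QCDRegularisation Nf) (V : Fin 4 → QCDLatticeObservable Nf 1)
    (P : QCDLatticeObservable Nf 1) (uV uP : ℕ → ℝ) (ε m₁ : ℝ),
    CruxHyps reg V P uV uP ε m₁ → HVol reg uV uP → TreeDecay reg V P uV uP m₁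

/-- **(B) Finite-size DESCENT of the far-region moment bound** (size M–L as physics; the isolated interface
debt of the crux as typed).  For every `N_f`, regularisation `reg`, observables, weights, `ε`, `m₁` and every
enlargement `L'_k ≥ L_k` of the volume thresholds: if the crux's hypotheses hold for `reg` (on all tori
`S ≥ L_k`) and the far-region weighted moments are m-uniformly bounded for the volume-enlarged regularisation
`enlargeL reg L'` (i.e. on the tori `S ≥ L'_k`), then they are m-uniformly bounded for `reg` (on the tori
`S ≥ L_k`).  Why plausibly true: in physical units the weighted correlators of honest lattice QCD with a uniform
gap `ε` in all sectors differ between the torus of side `(2S+1)a_k ≥ (2L_k+1)a_k → ∞` and larger tori by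
`O(e^{−ε a_k S})` (images / wrap-around), and a bounded correction to an L¹ moment over a far region is
harmless.  Why it might fail — AS INTERFACED: the per-pair constants of `HasLatticeMassGap` bound UNWEIGHTED
observables and nothing in the hypotheses ties them to the weights at `S = L_k`; lead c8 (b2) / c10's abstract
slow-mode scenario (one degenerate mode with unweighted overlaps `≤ C e^{−ε a_k L_k}` and weighted overlaps
`O(1)`) meets every hypothesis' shape and defeats the descent whenever `log |u(k)| ≳ ε a_k L_k`; so only
dynamical information about lattice QCD at volume `L_k` can prove it (c10: "unprovable as interfaced, not
false"; no constructible counterexample known).  Leaves the deciding path (`L' = L`) once the crux is restated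
with (H-vol) (`UniformGapFarMomentsLV`, the REPAIRABLE re-audit). [cite: Luscher1977]
[cite: MontvayMunster1994, §4.1 (antiperiodicity ⇔ trace)] -/
def VolumeDescentStmt : Prop :=
  ∀ (Nf : ℕ) (reg : QCDRegularisation Nf) (V : Fin 4 → QCDLatticeObservable Nf 1)
    (P : QCDLatticeObservable Nf 1) (uV uP : ℕ → ℝ) (ε m₁ : ℝ) (L' : ℕ → ℕ) (hL : ∀ k, reg.L k ≤ L' k),
    CruxHyps reg V P uV uP ε m₁ → FarMoments (enlargeL reg L' hL) V P uV uP m₁ → FarMoments reg V P uV uP m₁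

/-! ## §2 The registered stubs (the ONLY `sorry`s of this file) -/

/-- (A) uniform gap ⇒ m-uniform tree decay of the centred weighted three-point function at
super-logarithmic volumes — size L. -/
theorem stub_treeDecayLV : TreeDecayLVStmt := by
  sorry

/-- (B) finite-size descent of the far-region moment bound from enlarged volume thresholds — size M–L /
interface debt as typed. -/
theorem stub_volumeDescent : VolumeDescentStmt := by
  sorry

/-! ## §3 Composition (kernel-checked; no `sorry` below this line) -/

/-- Eventual statements "for all tori `S ≥ L_k`" are monotone under enlarging the thresholds. [folklore] -/
theorem eventually_forall_ge_mono {L L' : ℕ → ℕ} (hL : ∀ k, L k ≤ L' k) {Q : ℕ → ℕ → Prop}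
    (h : ∀ᶠ k in atTop, ∀ S : ℕ, L k ≤ S → Q k S) : ∀ᶠ k in atTop, ∀ S : ℕ, L' k ≤ S → Q k S :=
  h.mono fun k hk S hS => hk S ((hL k).trans hS)

/-- **Super-logarithmic volumes exist above any thresholds** (after lead c10, `lee_yang_mass_handover.lean`
§3): for spacings `a_k → 0⁺`, thresholds `L_k` and any weights there are `L'_k ≥ L_k` with
`a_k L'_k / log (2 + a_k⁻¹ + |u_V(k)| + |u_P(k)|) → ∞` (`L'_k := max L_k ⌈log²(…)/a_k⌉`). [folklore] -/
theorem exists_superlogVolume (a : ℕ → ℝ) (ha : ∀ k, 0 < a k) (hat : Tendsto a atTop (𝓝 0)) (L : ℕ → ℕ)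
    (uV uP : ℕ → ℝ) : ∃ L' : ℕ → ℕ, (∀ k, L k ≤ L' k) ∧
      Tendsto (fun k : ℕ => a k * (L' k : ℝ) / Real.log (2 + (a k)⁻¹ + |uV k| + |uP k|)) atTop atTop := by
  set g : ℕ → ℝ := fun k => 2 + (a k)⁻¹ + |uV k| + |uP k| with hg
  have hg2 : ∀ k, 2 ≤ g k := fun k => by
    have h1 : 0 ≤ (a k)⁻¹ := inv_nonneg.mpr (ha k).le
    have h2 : 0 ≤ |uV k| := abs_nonneg _
    have h3 : 0 ≤ |uP k| := abs_nonneg _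
    simp only [hg]; linarith
  have hlog_pos : ∀ k, 0 < Real.log (g k) := fun k => Real.log_pos (by linarith [hg2 k])
  refine ⟨fun k => max (L k) ⌈Real.log (g k) ^ 2 / a k⌉₊, fun k => le_max_left _ _, ?_⟩
  have hginv : Tendsto (fun k => (a k)⁻¹) atTop atTop :=
    tendsto_inv_nhdsGT_zero.comp (tendsto_nhdsWithin_iff.mpr ⟨hat, Eventually.of_forall fun k => ha k⟩)
  have hgt : Tendsto g atTop atTop := by
    refine tendsto_atTop_mono (fun k => ?_) hginv
    have h2 : 0 ≤ |uV k| := abs_nonneg _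
    have h3 : 0 ≤ |uP k| := abs_nonneg _
    simp only [hg]; linarith
  have hlogt : Tendsto (fun k => Real.log (g k)) atTop atTop := Real.tendsto_log_atTop.comp hgt
  refine tendsto_atTop_mono (fun k => ?_) hlogt
  have hak := ha k
  have hceil : Real.log (g k) ^ 2 / a k ≤ (⌈Real.log (g k) ^ 2 / a k⌉₊ : ℝ) := Nat.le_ceil _
  have hmax : (⌈Real.log (g k) ^ 2 / a k⌉₊ : ℝ) ≤ ((max (L k) ⌈Real.log (g k) ^ 2 / a k⌉₊ : ℕ) : ℝ) := by
    exact_mod_cast le_max_right _ _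
  have hprod : Real.log (g k) ^ 2 ≤ a k * ((max (L k) ⌈Real.log (g k) ^ 2 / a k⌉₊ : ℕ) : ℝ) := by
    calc Real.log (g k) ^ 2 = a k * (Real.log (g k) ^ 2 / a k) := by field_simp
      _ ≤ a k * ((max (L k) ⌈Real.log (g k) ^ 2 / a k⌉₊ : ℕ) : ℝ) :=
          mul_le_mul_of_nonneg_left (hceil.trans hmax) hak.le
  rw [le_div_iff₀ (hlog_pos k)]
  calc Real.log (g k) * Real.log (g k) = Real.log (g k) ^ 2 := by ring
    _ ≤ _ := hprod

/-- **The crux's hypotheses survive volume enlargement**: each is an eventual statement over all tori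
`S ≥ L_k` (pair bounds, gap clause, centring) or does not mention `L` at all (`ε`, `m₁`, physical branch,
`N_f`, asymptotic scaling). [folklore] -/
theorem cruxHyps_enlargeL {reg : QCDRegularisation Nf} {V : Fin 4 → QCDLatticeObservable Nf 1}
    {P : QCDLatticeObservable Nf 1} {uV uP : ℕ → ℝ} {ε m₁ : ℝ} (L' : ℕ → ℕ) (hL : ∀ k, reg.L k ≤ L' k)
    (H : CruxHyps reg V P uV uP ε m₁) : CruxHyps (enlargeL reg L' hL) V P uV uP ε m₁ := by
  dsimp only [CruxHyps, Centred] at H ⊢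
  obtain ⟨hU2, hε, hm₁, hm₁1, hgap, hbranch, hNf, hAS, hcV, hcP⟩ := H
  refine ⟨?_, hε, hm₁, hm₁1, ?_, hbranch, hNf, hAS, ?_, ?_⟩
  · -- pair bounds
    dsimp only [PairBounds] at hU2 ⊢
    obtain ⟨σ, hσ, hU⟩ := hU2
    refine ⟨σ, hσ, fun τ hτ => ?_⟩
    obtain ⟨C, hC⟩ := hU τ hτ
    exact ⟨C, fun m hm hm1 ι₁ ι₂ => eventually_forall_ge_mono hL (hC m hm hm1 ι₁ ι₂)⟩
  · -- the uniform lattice gap (thresholds inside `HasLatticeMassGap`)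
    intro m hm hm1 R R' A B
    obtain ⟨C, hC⟩ := hgap m hm hm1 R R' A B
    exact ⟨C, eventually_forall_ge_mono hL hC⟩
  · exact fun m hm hm1 μ => eventually_forall_ge_mono hL (hcV m hm hm1 μ)
  · exact fun m hm hm1 => eventually_forall_ge_mono hL (hcP m hm hm1)

/-- **Far-region summation, pure real analysis** (one torus, one weight exponent pair): if a kernel `g`
obeys the tree-decay bound beyond radius `R₀` and the far-region weight is summable with constant `Cf`
(`treeGerm_far_weight_sum`), the weighted far-region sum of `g` is at most `max C 0 · Cf`. [folklore] -/
theorem far_sum_le {a ε' σ R₀ CT Cf : ℝ} (ha : 0 < a) (S i j : ℕ) (φ : (Fin 4 → ℤ) → (Fin 4 → ℝ))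
    (g : (Fin 4 → ℤ) → (Fin 4 → ℤ) → ℝ)
    (htr : ∀ x ∈ box 4 S, ∀ y ∈ box 4 S, R₀ ≤ max ‖φ x‖ ‖φ y‖ →
      g x y ≤ CT * Real.exp (-(ε' * max ‖φ x‖ ‖φ y‖)) *
        (1 + (a + min ‖φ x‖ (min ‖φ y‖ ‖φ x - φ y‖)) ^ (-σ)))
    (hCf : ∑ x ∈ box 4 S, ∑ y ∈ box 4 S, a ^ 8 * ‖φ x‖ ^ i * ‖φ y‖ ^ j *
      (Real.exp (-(ε' * max ‖φ x‖ ‖φ y‖)) * (1 + (a + min ‖φ x‖ (min ‖φ y‖ ‖φ x - φ y‖)) ^ (-σ))) ≤ Cf) :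
    (∑ x ∈ box 4 S, ∑ y ∈ box 4 S,
      if R₀ ≤ max ‖φ x‖ ‖φ y‖ then a ^ 8 * ‖φ x‖ ^ i * ‖φ y‖ ^ j * g x y else 0) ≤ max CT 0 * Cf := by
  have hE0 : ∀ x y : Fin 4 → ℤ, 0 ≤ Real.exp (-(ε' * max ‖φ x‖ ‖φ y‖)) *
      (1 + (a + min ‖φ x‖ (min ‖φ y‖ ‖φ x - φ y‖)) ^ (-σ)) := by
    intro x y
    have h1 : 0 ≤ (a + min ‖φ x‖ (min ‖φ y‖ ‖φ x - φ y‖)) ^ (-σ) :=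
      Real.rpow_nonneg (add_nonneg ha.le (le_min (norm_nonneg _) (le_min (norm_nonneg _) (norm_nonneg _)))) _
    exact mul_nonneg (Real.exp_nonneg _) (add_nonneg zero_le_one h1)
  have hpt : ∀ x ∈ box 4 S, ∀ y ∈ box 4 S,
      (if R₀ ≤ max ‖φ x‖ ‖φ y‖ then a ^ 8 * ‖φ x‖ ^ i * ‖φ y‖ ^ j * g x y else 0) ≤
        max CT 0 * (a ^ 8 * ‖φ x‖ ^ i * ‖φ y‖ ^ j *
          (Real.exp (-(ε' * max ‖φ x‖ ‖φ y‖)) * (1 + (a + min ‖φ x‖ (min ‖φ y‖ ‖φ x - φ y‖)) ^ (-σ)))) := by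
    intro x hx y hy
    have hW0 : 0 ≤ a ^ 8 * ‖φ x‖ ^ i * ‖φ y‖ ^ j := by positivity
    split_ifs with hfar
    · have hb := htr x hx y hy hfar
      have hb' : g x y ≤ max CT 0 * (Real.exp (-(ε' * max ‖φ x‖ ‖φ y‖)) *
          (1 + (a + min ‖φ x‖ (min ‖φ y‖ ‖φ x - φ y‖)) ^ (-σ))) := by
        calc g x y ≤ CT * Real.exp (-(ε' * max ‖φ x‖ ‖φ y‖)) *
              (1 + (a + min ‖φ x‖ (min ‖φ y‖ ‖φ x - φ y‖)) ^ (-σ)) := hb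
          _ = CT * (Real.exp (-(ε' * max ‖φ x‖ ‖φ y‖)) *
              (1 + (a + min ‖φ x‖ (min ‖φ y‖ ‖φ x - φ y‖)) ^ (-σ))) := by ring
          _ ≤ _ := mul_le_mul_of_nonneg_right (le_max_left _ _) (hE0 x y)
      calc a ^ 8 * ‖φ x‖ ^ i * ‖φ y‖ ^ j * g x y
          ≤ a ^ 8 * ‖φ x‖ ^ i * ‖φ y‖ ^ j * (max CT 0 * (Real.exp (-(ε' * max ‖φ x‖ ‖φ y‖)) *
              (1 + (a + min ‖φ x‖ (min ‖φ y‖ ‖φ x - φ y‖)) ^ (-σ)))) :=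
            mul_le_mul_of_nonneg_left hb' hW0
        _ = _ := by ring
    · exact mul_nonneg (le_max_right _ _) (mul_nonneg hW0 (hE0 x y))
  calc (∑ x ∈ box 4 S, ∑ y ∈ box 4 S,
        if R₀ ≤ max ‖φ x‖ ‖φ y‖ then a ^ 8 * ‖φ x‖ ^ i * ‖φ y‖ ^ j * g x y else 0)
      ≤ ∑ x ∈ box 4 S, ∑ y ∈ box 4 S, max CT 0 * (a ^ 8 * ‖φ x‖ ^ i * ‖φ y‖ ^ j *
          (Real.exp (-(ε' * max ‖φ x‖ ‖φ y‖)) * (1 + (a + min ‖φ x‖ (min ‖φ y‖ ‖φ x - φ y‖)) ^ (-σ)))) :=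
        Finset.sum_le_sum fun x hx => Finset.sum_le_sum fun y hy => hpt x hx y hy
    _ = max CT 0 * ∑ x ∈ box 4 S, ∑ y ∈ box 4 S, a ^ 8 * ‖φ x‖ ^ i * ‖φ y‖ ^ j *
          (Real.exp (-(ε' * max ‖φ x‖ ‖φ y‖)) * (1 + (a + min ‖φ x‖ (min ‖φ y‖ ‖φ x - φ y‖)) ^ (-σ))) := by
        rw [Finset.mul_sum]
        exact Finset.sum_congr rfl fun x _ => by rw [Finset.mul_sum]
    _ ≤ max CT 0 * Cf := mul_le_mul_of_nonneg_left hCf (le_max_right _ _)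

/-- **Pointwise tree decay ⇒ far-region moments** (the route header's "sum the pointwise bound": near nothing,
far region by the landed `treeGerm_far_weight_sum`, using `a_k ≤ 1` eventually; the same `R₀`, constant
`max C 0 · Cf` uniform in `m, i, j, μ, ν, k, S`). [cite: GlimmJaffe1987, §6.1] -/
theorem farMoments_of_treeDecay (reg : QCDRegularisation Nf) (V : Fin 4 → QCDLatticeObservable Nf 1)
    (P : QCDLatticeObservable Nf 1) (uV uP : ℕ → ℝ) (m₁ : ℝ) (h : TreeDecay reg V P uV uP m₁) :
    FarMoments reg V P uV uP m₁ := by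
  dsimp only [TreeDecay] at h
  dsimp only [FarMoments]
  obtain ⟨CT, ε', σ, R₀, hε', hσ, htree⟩ := h
  obtain ⟨Cf, hCf0, hCf⟩ := treeGerm_far_weight_sum ε' σ hε' hσ
  have ha1 : ∀ᶠ k in atTop, reg.a k ≤ 1 := reg.tendsto_a.eventually (eventually_le_nhds one_pos)
  refine ⟨R₀, max CT 0 * Cf, fun m hm hm1 i j hi1 hi2 hj1 hj2 μ ν => ?_⟩
  filter_upwards [htree m hm hm1 μ ν, ha1] with k htr hak S hS
  set φ : (Fin 4 → ℤ) → (Fin 4 → ℝ) := fun x i => reg.a k * (x i : ℝ) with hφ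
  have hφx : ∀ x : Fin 4 → ℤ, (fun i => reg.a k * (x i : ℝ)) = φ x := fun x => rfl
  simp only [hφx] at htr ⊢
  exact far_sum_le (reg.a_pos k) S i j φ _ (htr S hS)
    (hCf (reg.a k) (reg.a_pos k) hak φ (fun x i => rfl) S i j hi2 hj2)

/-- **The crux from the two stubs** (concludes `UniformGapFarMoments` BY NAME).  Enlarge the thresholds
super-logarithmically (`exists_superlogVolume`), transport the hypotheses (`cruxHyps_enlargeL`), get pointwise
tree decay on the enlarged tori from stub (A), sum it (`farMoments_of_treeDecay`, landed engine), descend with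
stub (B). -/
theorem UniformGapFarMoments_of : TreeDecayLVStmt → VolumeDescentStmt → UniformGapFarMoments := by
  intro hA hB Nf reg V P uV uP ε m₁
  dsimp only
  intro hU2 hε hm₁ hm₁1 hgap hbranch hNf hAS hcV hcP
  have H : CruxHyps reg V P uV uP ε m₁ := by
    dsimp only [CruxHyps, Centred, PairBounds]
    exact ⟨hU2, hε, hm₁, hm₁1, hgap, hbranch, hNf, hAS, hcV, hcP⟩
  -- enlarge the volume thresholds super-logarithmically
  obtain ⟨L', hL, hvol⟩ := exists_superlogVolume reg.a reg.a_pos reg.tendsto_a reg.L uV uP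
  have H' : CruxHyps (enlargeL reg L' hL) V P uV uP ε m₁ := cruxHyps_enlargeL L' hL H
  have hvol' : HVol (enlargeL reg L' hL) uV uP := hvol
  -- stub (A) on the enlarged regularisation, then the landed summation
  have htd : TreeDecay (enlargeL reg L' hL) V P uV uP m₁ := hA Nf (enlargeL reg L' hL) V P uV uP ε m₁ H' hvol'
  have hfar' : FarMoments (enlargeL reg L' hL) V P uV uP m₁ :=
    farMoments_of_treeDecay (enlargeL reg L' hL) V P uV uP m₁ htd
  -- stub (B): descend to the scheme's own tori
  have hfin : FarMoments reg V P uV uP m₁ := hB Nf reg V P uV uP ε m₁ L' hL H hfar'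
  dsimp only [FarMoments] at hfin
  exact hfin

/-- The crux along this skeleton, from the registered stubs (sorries only inside `stub_*`). -/
theorem uniformGapFarMoments_of_stubs : UniformGapFarMoments :=
  UniformGapFarMoments_of stub_treeDecayLV stub_volumeDescent

end Summit.QuantumFields.QCD.Cruxes.UniformGapFarMoments.Birth

end
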